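import Summits.CriticalPhenomena.PercolationContinuityZ3.Theorems.PercNearOneGluingNoHeavyLowerTailBlockGluing
import Mathlib.Data.List.GetD
import HarnessLib

/-!
# `NoHeavyLowerTail` (stmt-CriticalPhenomena-4575) — WORST-FIRST GLUING FOR EVERY `|A|` UNDER THE PREFIX CONDITION

Support file (prover prim-gen-kcluster gen 3; `--supports stmt-CriticalPhenomena-4575`).  No definitions, no sorries.
Relays are given as a list `l = [a₀, a₁, …, a_{k−1}]` (worst first); `A_{<j} = (l.take j).toFinset`, `a_j = l.getD j o`,
`d_j = μ(a_j ↮ b)`.  The PREFIX CONDITION is `μ(A_{<j} ↮ b) ≥ d_j` for every `0 < j < k` (`A_{<j} ↮ b` = every worse relay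
cut from `b`; it implies `d_0 ≥ d_1 ≥ …`), together with non-degeneracy `μ(A_{<j} ↮ b, a_j ↮ b, a_j ↮ A_{<j}) > 0`.

* `prefixBlockGluing` (PROVED, all `k`): under the prefix condition,
  `Σ_{j<k} μ({o↔a_j} ∩ {o↮A_{<j}} ∩ {a_j↮b}) / d_j ≤ μ({o↔A} ∩ {A↮b}) / μ(A↮b)`
  — the worst-first gluing sum is at most `P(o ↔ A | A ↮ b)`;  `prefixWorstFirstGluing`: hence `≤ 1`.
  Proof: induction along the list, each step being the block two-point step `blockGluing_two` (merge `A_{<j}` with `a_j`).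
  So worst-first gluing (WF), and with it event gluing / AdditiveGluing / NoHeavyLowerTail via `…WorstFirstGluing.lean`, hold on
  the whole prefix-condition regime for every number of relays; the complementary regime is the open "case B" (KCLUSTER-gen3.md).
-/

noncomputable section

namespace Summit.CriticalPhenomena.PercolationContinuityZ3.Theorems

open MeasureTheory Set Literature.Probability.LatticeModels Literature.Probability.Percolation
open scoped Classical BigOperators
open PathExchange (rs)

namespace BlockStep

variable {V : Type*}

/-- **Worst-first gluing under the prefix condition, block form (PROVED, every `|A|`).** [this file] -/
theorem prefixBlockGluing [Fintype V] (w : Sym2 V → unitInterval) (o b : V) (l : List V)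
    (hpre : ∀ j, j < l.length → 0 < j →
      (prodBernoulli w).real (openConn (l.getD j o) b : Set (BondConfig V))ᶜ ≤
        (prodBernoulli w).real {ω : BondConfig V | ∀ s ∈ (l.take j).toFinset, ¬ (openGraph ω).Reachable s b})
    (hL : ∀ j, j < l.length → 0 < j →
      0 < (prodBernoulli w).real ({ω : BondConfig V | ∀ s ∈ (l.take j).toFinset, ¬ (openGraph ω).Reachable s b} ∩
        (openConn (l.getD j o) b)ᶜ ∩ (⋃ s ∈ (l.take j).toFinset, (openConn (l.getD j o) s : Set (BondConfig V)))ᶜ)) :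
    ((List.range l.length).map fun j =>
        (prodBernoulli w).real ((openConn o (l.getD j o) : Set (BondConfig V)) ∩
            (⋃ s ∈ (l.take j).toFinset, (openConn o s : Set (BondConfig V)))ᶜ ∩ (openConn (l.getD j o) b)ᶜ) /
          (prodBernoulli w).real (openConn (l.getD j o) b : Set (BondConfig V))ᶜ).sum ≤
      (prodBernoulli w).real ((⋃ s ∈ l.toFinset, (openConn o s : Set (BondConfig V))) ∩
          {ω | ∀ s ∈ l.toFinset, ¬ (openGraph ω).Reachable s b}) /
        (prodBernoulli w).real {ω : BondConfig V | ∀ s ∈ l.toFinset, ¬ (openGraph ω).Reachable s b} := by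
  induction l using List.reverseRecOn with
  | nil =>
    simp only [List.length_nil, List.range_zero, List.map_nil, List.sum_nil]
    exact div_nonneg measureReal_nonneg measureReal_nonneg
  | append_singleton l' y IH =>
    set μ := prodBernoulli w with hμ
    -- the term function of the longer list agrees with that of `l'` below `l'.length`
    set f : List V → ℕ → ℝ := fun L j =>
      μ.real ((openConn o (L.getD j o) : Set (BondConfig V)) ∩
          (⋃ s ∈ (L.take j).toFinset, (openConn o s : Set (BondConfig V)))ᶜ ∩ (openConn (L.getD j o) b)ᶜ) /
        μ.real (openConn (L.getD j o) b : Set (BondConfig V))ᶜ with hf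
    have hlen : (l' ++ [y]).length = l'.length + 1 := by simp
    have hgetD_lt : ∀ j, j < l'.length → (l' ++ [y]).getD j o = l'.getD j o :=
      fun j hj => List.getD_append _ _ _ _ hj
    have hgetD_last : (l' ++ [y]).getD l'.length o = y := by
      rw [List.getD_append_right _ _ _ _ le_rfl]; simp
    have htake_lt : ∀ j, j ≤ l'.length → (l' ++ [y]).take j = l'.take j :=
      fun j hj => List.take_append_of_le_length hj
    have htake_last : (l' ++ [y]).take l'.length = l' := by simp
    have hsum : ((List.range (l' ++ [y]).length).map (f (l' ++ [y]))).sum =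
        ((List.range l'.length).map (f l')).sum + f (l' ++ [y]) l'.length := by
      rw [hlen, List.range_succ, List.map_append, List.sum_append, List.map_singleton, List.sum_singleton]
      congr 1
      refine congrArg List.sum (List.map_congr_left fun j hj => ?_)
      have hj' : j < l'.length := List.mem_range.1 hj
      simp only [hf, hgetD_lt j hj', htake_lt j hj'.le]
    -- hypotheses for the shorter list
    have hpre' : ∀ j, j < l'.length → 0 < j →
        μ.real (openConn (l'.getD j o) b : Set (BondConfig V))ᶜ ≤
          μ.real {ω : BondConfig V | ∀ s ∈ (l'.take j).toFinset, ¬ (openGraph ω).Reachable s b} := by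
      intro j hj hj0
      have h := hpre j (by rw [hlen]; omega) hj0
      rw [hgetD_lt j hj, htake_lt j hj.le] at h; exact h
    have hL' : ∀ j, j < l'.length → 0 < j →
        0 < μ.real ({ω : BondConfig V | ∀ s ∈ (l'.take j).toFinset, ¬ (openGraph ω).Reachable s b} ∩
          (openConn (l'.getD j o) b)ᶜ ∩ (⋃ s ∈ (l'.take j).toFinset, (openConn (l'.getD j o) s : Set (BondConfig V)))ᶜ) := by
      intro j hj hj0
      have h := hL j (by rw [hlen]; omega) hj0
      rw [hgetD_lt j hj, htake_lt j hj.le] at h; exact h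
    have hIH := IH hpre' hL'
    -- the last term
    have hlast : f (l' ++ [y]) l'.length = μ.real ((openConn o y : Set (BondConfig V)) ∩
        (⋃ s ∈ l'.toFinset, (openConn o s : Set (BondConfig V)))ᶜ ∩ (openConn y b)ᶜ) /
        μ.real (openConn y b : Set (BondConfig V))ᶜ := by
      simp only [hf, hgetD_last, htake_last]
    -- set identities for the longer block
    have eU : (⋃ s ∈ (l' ++ [y]).toFinset, (openConn o s : Set (BondConfig V))) =
        (⋃ s ∈ l'.toFinset, (openConn o s : Set (BondConfig V))) ∪ openConn o y := by
      ext ω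
      simp only [List.toFinset_append, List.toFinset_cons, List.toFinset_nil, Finset.insert_empty,
        Finset.mem_union, Finset.mem_singleton, mem_iUnion, mem_union, exists_prop]
      constructor
      · rintro ⟨s, hs | rfl, h⟩
        · exact Or.inl ⟨s, hs, h⟩
        · exact Or.inr h
      · rintro (⟨s, hs, h⟩ | h)
        · exact ⟨s, Or.inl hs, h⟩
        · exact ⟨y, Or.inr rfl, h⟩
    have eS : {ω : BondConfig V | ∀ s ∈ (l' ++ [y]).toFinset, ¬ (openGraph ω).Reachable s b} =
        {ω : BondConfig V | ∀ s ∈ l'.toFinset, ¬ (openGraph ω).Reachable s b} ∩ (openConn y b)ᶜ := by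
      ext ω
      simp only [List.toFinset_append, List.toFinset_cons, List.toFinset_nil, Finset.insert_empty,
        Finset.mem_union, Finset.mem_singleton, mem_setOf_eq, mem_inter_iff, mem_compl_iff, openConn]
      constructor
      · intro h; exact ⟨fun s hs => h s (Or.inl hs), h y (Or.inr rfl)⟩
      · rintro ⟨h1, h2⟩ s (hs | rfl)
        · exact h1 s hs
        · exact h2
    rw [hsum, hlast, eU, eS]
    rcases Nat.eq_zero_or_pos l'.length with hl0 | hlpos
    · -- base: `l' = []`
      have hnil : l' = [] := List.length_eq_zero_iff.1 hl0
      subst hnil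
      simp only [List.length_nil, List.range_zero, List.map_nil, List.sum_nil, zero_add, List.toFinset_nil,
        Finset.notMem_empty, IsEmpty.forall_iff, implies_true, setOf_true, iUnion_of_empty, iUnion_empty,
        compl_empty, inter_univ, empty_union, univ_inter]
      exact le_of_eq (by rw [inter_comm])
    · -- step: the block two-point step with `S = l'.toFinset`
      have hpreL := hpre l'.length (by rw [hlen]; omega) hlpos
      rw [hgetD_last, htake_last] at hpreL
      have hLL := hL l'.length (by rw [hlen]; omega) hlpos
      rw [hgetD_last, htake_last] at hLL
      have step := blockGluing_two w l'.toFinset o b y hpreL hLL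
      linarith [hIH, step]

/-- **Worst-first gluing (WF) for every `|A|` under the prefix condition (PROVED):** the worst-first gluing sum is
`≤ 1`. [this file] -/
theorem prefixWorstFirstGluing [Fintype V] (w : Sym2 V → unitInterval) (o b : V) (l : List V)
    (hpre : ∀ j, j < l.length → 0 < j →
      (prodBernoulli w).real (openConn (l.getD j o) b : Set (BondConfig V))ᶜ ≤
        (prodBernoulli w).real {ω : BondConfig V | ∀ s ∈ (l.take j).toFinset, ¬ (openGraph ω).Reachable s b})
    (hL : ∀ j, j < l.length → 0 < j →
      0 < (prodBernoulli w).real ({ω : BondConfig V | ∀ s ∈ (l.take j).toFinset, ¬ (openGraph ω).Reachable s b} ∩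
        (openConn (l.getD j o) b)ᶜ ∩ (⋃ s ∈ (l.take j).toFinset, (openConn (l.getD j o) s : Set (BondConfig V)))ᶜ)) :
    ((List.range l.length).map fun j =>
        (prodBernoulli w).real ((openConn o (l.getD j o) : Set (BondConfig V)) ∩
            (⋃ s ∈ (l.take j).toFinset, (openConn o s : Set (BondConfig V)))ᶜ ∩ (openConn (l.getD j o) b)ᶜ) /
          (prodBernoulli w).real (openConn (l.getD j o) b : Set (BondConfig V))ᶜ).sum ≤ 1 :=
  (prefixBlockGluing w o b l hpre hL).trans
    (div_le_one_of_le₀ (measureReal_mono Set.inter_subset_right) measureReal_nonneg)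

end BlockStep

end Summit.CriticalPhenomena.PercolationContinuityZ3.Theorems

end
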